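import Summits.CriticalPhenomena.SAWScalingLimit.Theorems.SAWDevelopingMapObservableToSLETypeLadderCarvedReductionSqueezeSupCorridors
import Summits.CriticalPhenomena.SAWScalingLimit.Theorems.SAWDevelopingMapObservableToSLETypeLadderCarvedReductionSqueezeSuperFrame
import Summits.CriticalPhenomena.SAWScalingLimit.Theorems.SAWDevelopingMapObservableToSLETypeLadderCarvedReductionSqueezeLinkSup
import Summits.CriticalPhenomena.SAWScalingLimit.Theorems.SAWDevelopingMapObservableToSLETypeLadderCarvedReductionSqueezeReachSup
import Summits.CriticalPhenomena.SAWScalingLimit.Theorems.SAWDevelopingMapObservableToSLETypeLadderCarvedReductionSqueezeSupGateData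
import HarnessLib

/-!
# The OUTER two-piece flat super-domain of the pinned frame with its gate boxes and the reach
# clause (R): assembly of P1–P4 (piece (T-A′ E^sup) of stub T-A′
# `stub_carvedReduction_squeezeGeometry_domains`)

Crux `SAWDevelopingMap.ObservableToSLE` (stmt-CriticalPhenomena-10472), line `six-class-type-ladder`,
stub T-A′ `stub_carvedReduction_squeezeGeometry_domains`.  Landing target:
`Summits/CriticalPhenomena/SAWScalingLimit/Theorems/SAWDevelopingMapObservableToSLETypeLadderCarvedReductionSqueezeSuperSup.lean`
(`--supports stmt-CriticalPhenomena-10472`; registered carrier `stub_carvedReduction_superSup`).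

Worker log §E, steps E2–E9, for data ALREADY reindexed along the final subsequence (index map
`κ`, meshes `s_j = δ (κ j)`): from the tame families, the realised gates (`hgates`), the pinned
frame of STAGE 1a (gates `P₀, P₁` approached from above, exact windows of radius `ρ/2`, window
balls in `D`), the limit bodies of `squeeze_limitPackage` with their per-level approximants, and
the D-level envelope data `(H, d, β, ε)` of `stub_carvedReduction_envelopeData` under the
smallness `ρ ≤ R`, `R + ρ ≤ ε`, `2 (R + ρ) < dist (D.pt 0) (D.pt 1)`: the Dobrushin domain `E`
(= `E^sup`) with `E.pt i = Pᵢ`, exact upper half-discs of radius `ρ/128`, the closed gate boxes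
`[re Pᵢ ± ρ/64] × [im Pᵢ - ρ/128, im Pᵢ]` outside `E`, and the reach clause (R) of STAGE 2 with
`ρc = ρ/64` (disc part), together with the envelope `J`, the cuts and the exit zones for the
sequel (limit bulk, outer approximants).
-/

noncomputable section

open scoped Topology ComplexConjugate
open Filter Set Metric Bornology
open Literature.Probability.LatticeModels (HexVertex hexGraph hexCenter triZeta triEmbed Site)
open Literature.Probability.RandomPlanarGeometry
open Literature.Probability.RandomPlanarGeometry.SAW
open Literature.Topology.PlaneTopology

namespace Summit.CriticalPhenomena.SAWScalingLimit.Theorems.ObservableToSLE.TypeLadder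

open Summit.CriticalPhenomena.SAWScalingLimit.Theorems.ObservableToSLER.BridgeGate (HasCleanWindow)
open Summit.CriticalPhenomena.SAWScalingLimit.Theorems.ObservableToSLER.NestedGate

/-- **Registered carrier `stub_carvedReduction_superSup`** (crux item stmt-CriticalPhenomena-10472,
stub T-A′ `stub_carvedReduction_squeezeGeometry_domains`, piece THE OUTER SUPER-DOMAIN — short
carrier): the docks of the lowered window (abscissa offset `|σ| ≤ ρ/64`, depth between `ρ/128` and
`ρ/64`) lie in the window ball `ball P (ρ/2)` (so the exits, which are off that ball, miss them). -/
theorem stub_carvedReduction_superSup :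
    ∀ (P : ℂ) (ρ σ t : ℝ), 0 < ρ → |σ| ≤ ρ / 64 → 0 ≤ t → t ≤ ρ / 128 →
      P - ((ρ / 128 : ℝ) : ℂ) * Complex.I + σ - (t : ℂ) * Complex.I ∈ ball P (ρ / 2) := by
  intro P ρ σ t hρ hσ ht0 ht1
  rw [mem_ball, dist_eq_norm]
  have : P - ((ρ / 128 : ℝ) : ℂ) * Complex.I + σ - (t : ℂ) * Complex.I - P = (σ : ℂ) + ((-(ρ / 128 + t) : ℝ) : ℂ) * Complex.I := by
    push_cast; ring
  rw [this]
  refine (norm_add_le _ _).trans_lt ?_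
  rw [Complex.norm_real, norm_mul, Complex.norm_real, Complex.norm_I, mul_one, Real.norm_eq_abs, Real.norm_eq_abs,
    abs_neg, abs_of_nonneg (by linarith : 0 ≤ ρ / 128 + t)]
  linarith

/-- **The OUTER two-piece flat super-domain with its gate boxes and the reach clause (R)** (worker
log E2–E9); see the module docstring. -/
theorem superSup :
    ∀ (D : DobrushinDomain) (a b : ℝ → HexVertex), IsEmbEndpointApprox hexGraph hexCenter D a b →
    ∀ (δ : ℕ → ℝ) (ρ R : ℝ) (N : ℕ) (S T : ℕ → ℕ → Set HexVertex) (n n' : ℕ → ℕ) (q q' : ℕ → HexVertex)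
      (κ : ℕ → ℕ) (x : ℕ → Site 2) (τ P₀ P₁ : ℂ) (H : ℂ ≃ₜ ℂ) (d : Fin 2 → ℂ) (β ε : ℝ)
      (BS BT : Set ℂ) (BpS BpT : ℕ → Set ℂ),
      0 < ρ → ρ ≤ R → R + ρ ≤ ε → 2 * (R + ρ) < dist (D.pt 0) (D.pt 1) →
      (∀ j, 0 < δ (κ j)) → Tendsto (fun j => δ (κ j)) atTop (𝓝 0) →
      Tendsto (fun j => ((δ (κ j) : ℝ) : ℂ) * triEmbed (x j)) atTop (𝓝 τ) →
      (∀ j, TameNestedFamily (δ (κ j)) R N (a (δ (κ j))) (S (κ j)) ∧ TameNestedFamily (δ (κ j)) R N (b (δ (κ j))) (T (κ j))) →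
      (∀ k, ∃ (γ : HexDomainSAW D.carrier (δ k) (a (δ k)) (b (δ k))) (m : ℕ) (p : HexVertex) (m' : ℕ) (p' : HexVertex),
        IsFirstGoodGateN D.carrier (δ k) ρ R (S k) (a (δ k)) γ.walk.support (n k) m p (q k) ∧
        IsFirstGoodGateN D.carrier (δ k) ρ R (T k) (b (δ k)) γ.walk.support.reverse (n' k) m' p' (q' k) ∧
        WideLink D.carrier (δ k) ρ (S k (n k) ∪ T k (n' k)) (q k) (q' k)) →
      (∀ k, (q k).2 = 0) → (∀ k, (q' k).2 = 0) →
      Tendsto (fun j => ((δ (κ j) : ℝ) : ℂ) * hexCenter (((q (κ j)).1 - x j, 0) : HexVertex)) atTop (𝓝 P₀) →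
      Tendsto (fun j => ((δ (κ j) : ℝ) : ℂ) * hexCenter (((q' (κ j)).1 - x j, 0) : HexVertex)) atTop (𝓝 P₁) →
      (∀ j, P₀.im < (((δ (κ j) : ℝ) : ℂ) * hexCenter (((q (κ j)).1 - x j, 0) : HexVertex)).im) →
      (∀ j, P₁.im < (((δ (κ j) : ℝ) : ℂ) * hexCenter (((q' (κ j)).1 - x j, 0) : HexVertex)).im) →
      (∀ᶠ j in atTop, ∀ v : HexVertex,
        ((δ (κ j) : ℝ) : ℂ) * hexCenter v - ((δ (κ j) : ℝ) : ℂ) * triEmbed (x j) ∈ ball P₀ (ρ / 2) →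
          (v ∈ S (κ j) (n (κ j)) ∪ T (κ j) (n' (κ j)) ↔ v.1 1 < (q (κ j)).1 1)) →
      (∀ᶠ j in atTop, ∀ v : HexVertex,
        ((δ (κ j) : ℝ) : ℂ) * hexCenter v - ((δ (κ j) : ℝ) : ℂ) * triEmbed (x j) ∈ ball P₁ (ρ / 2) →
          (v ∈ S (κ j) (n (κ j)) ∪ T (κ j) (n' (κ j)) ↔ v.1 1 < (q' (κ j)).1 1)) →
      (∀ᶠ j in atTop, closedBall (P₀ + ((δ (κ j) : ℝ) : ℂ) * triEmbed (x j)) (ρ / 2) ⊆ D.carrier ∧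
        closedBall (P₁ + ((δ (κ j) : ℝ) : ℂ) * triEmbed (x j)) (ρ / 2) ⊆ D.carrier) →
      (∀ j, q (κ j) ∈ embMeshDomain hexGraph hexCenter D.carrier (δ (κ j))) →
      -- the D-level envelope data
      (∀ i, H (d i) = D.pt i) →
      (∀ (τ' : ℂ) (i k : Fin 2), i ≠ k →
        Disjoint ((H.trans (Homeomorph.addRight (-τ'))) ''
            {w : ℂ | 1 ≤ (w * conj (d k)).re ∧ (1 - β) * ‖w‖ ≤ (w * conj (d k)).re})
          (ball (H (d i) - τ') ε)) →
      (∀ (τ' : ℂ) (ϱ₀ ζ : ℝ), 0 < ζ →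
        ∃ (r₁ r₂ : ℝ) (J : JordanDomain) (η : Fin 2 → Set ℂ) (xx : Fin 2 → Fin 2 → ℂ) (F : Fin 2 → Set ℂ),
          1 < r₁ ∧ r₁ < r₂ ∧
          J.carrier = (H.trans (Homeomorph.addRight (-τ'))) '' ball 0 r₂ ∧
          frontier J.carrier = (H.trans (Homeomorph.addRight (-τ'))) '' sphere 0 r₂ ∧
          closure ((fun z => z - τ') '' D.carrier) = (H.trans (Homeomorph.addRight (-τ'))) '' closedBall 0 1 ∧
          closure ((fun z => z - τ') '' D.carrier) ⊆ J.carrier ∧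
          (∀ i, closedBall (D.pt i - τ') ϱ₀ ⊆ J.carrier) ∧
          (∀ i, J.IsCrosscut (η i) (xx i 0) (xx i 1)) ∧ (∀ i, η i \ {xx i 0, xx i 1} ⊆ F i) ∧
          (∀ i, IsOpen (F i)) ∧ (∀ i, IsConnected (F i)) ∧ (∀ i, F i ⊆ J.carrier) ∧
          (∀ i, Disjoint (closure (F i)) ((H.trans (Homeomorph.addRight (-τ'))) '' closedBall 0 1)) ∧
          (∀ i, F i ⊆ (H.trans (Homeomorph.addRight (-τ'))) ''
            {w : ℂ | 1 ≤ (w * conj (d i)).re ∧ (1 - β) * ‖w‖ < (w * conj (d i)).re}) ∧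
          Disjoint (F 0 ∪ {xx 0 0, xx 0 1}) (F 1 ∪ {xx 1 0, xx 1 1}) ∧
          (∀ i, ∃ z ∈ F i, dist z (D.pt i - τ') < ζ) ∧
          (∀ i k, xx i k ∈ frontier J.carrier)) →
      -- the limit bodies of the package
      (IsCompact BS ∧ IsConnected BS ∧ D.pt 0 - τ ∈ BS ∧ P₀ - ((ρ / 2 : ℝ) : ℂ) * Complex.I ∈ BS) →
      (IsCompact BT ∧ IsConnected BT ∧ D.pt 1 - τ ∈ BT ∧ P₁ - ((ρ / 2 : ℝ) : ℂ) * Complex.I ∈ BT) →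
      (∀ j, IsCompact (BpS j) ∧ IsConnected (BpS j) ∧ ∀ v : HexVertex,
        infDist (((δ (κ j) : ℝ) : ℂ) * hexCenter v - ((δ (κ j) : ℝ) : ℂ) * triEmbed (x j)) (BpS j) ≤ ρ / 4 →
          v ∈ S (κ j) (n (κ j))) →
      (∀ j, IsCompact (BpT j) ∧ IsConnected (BpT j) ∧ ∀ v : HexVertex,
        infDist (((δ (κ j) : ℝ) : ℂ) * hexCenter v - ((δ (κ j) : ℝ) : ℂ) * triEmbed (x j)) (BpT j) ≤ ρ / 4 →
          v ∈ T (κ j) (n' (κ j))) →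
      Tendsto (fun j => hausdorffDist (BpS j) BS) atTop (𝓝 0) → Tendsto (fun j => hausdorffDist (BpT j) BT) atTop (𝓝 0) →
      (∀ ε₁ > (0 : ℝ), ∀ᶠ j in atTop, ∀ v : HexVertex,
        (infDist (((δ (κ j) : ℝ) : ℂ) * hexCenter v - ((δ (κ j) : ℝ) : ℂ) * triEmbed (x j)) BS ≤ ρ / 4 - ε₁ →
          v ∈ S (κ j) (n (κ j))) ∧
        (infDist (((δ (κ j) : ℝ) : ℂ) * hexCenter v - ((δ (κ j) : ℝ) : ℂ) * triEmbed (x j)) BT ≤ ρ / 4 - ε₁ →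
          v ∈ T (κ j) (n' (κ j)))) →
      ∃ (E : DobrushinDomain) (J : JordanDomain) (L F : Fin 2 → Set ℂ) (xx : Fin 2 → Fin 2 → ℂ),
        E.pt 0 = P₀ ∧ E.pt 1 = P₁ ∧
        (∀ i, E.carrier ∩ ball (E.pt i) (ρ / 128) = {z : ℂ | (E.pt i).im < z.im} ∩ ball (E.pt i) (ρ / 128)) ∧
        (∀ i (z : ℂ), |z.re - (E.pt i).re| ≤ ρ / 64 → (E.pt i).im - ρ / 128 ≤ z.im → z.im ≤ (E.pt i).im → z ∉ E.carrier) ∧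
        (∀ᶠ j in atTop, ∀ (w : HexVertex) (π : (hexDomainGraph D.carrier (δ (κ j))).Walk (q (κ j)) w),
          (∀ y ∈ π.support, y ∉ S (κ j) (n (κ j)) ∪ T (κ j) (n' (κ j))) → ∀ y ∈ π.support,
            ((δ (κ j) : ℝ) : ℂ) * hexCenter y - ((δ (κ j) : ℝ) : ℂ) * triEmbed (x j) ∈ E.carrier ∧
            closedBall (((δ (κ j) : ℝ) : ℂ) * hexCenter y - ((δ (κ j) : ℝ) : ℂ) * triEmbed (x j)) (25 * δ (κ j)) ⊆
              E.carrier ∪ ⋃ i, {z : ℂ | |z.re - (E.pt i).re| ≤ ρ / 64 ∧ (E.pt i).im - 30 * δ (κ j) ≤ z.im ∧ z.im ≤ (E.pt i).im}) ∧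
        -- for the sequel
        E.carrier ⊆ J.carrier \ (L 0 ∪ L 1) ∧
        (∀ z : ℂ, JoinedIn (J.carrier \ (L 0 ∪ L 1)) z (P₀ + (((ρ / 128) / 2 : ℝ) : ℂ) * Complex.I) → z ∈ E.carrier) ∧
        frontier E.carrier ⊆ L 0 ∪ L 1 ∪ frontier J.carrier ∧
        closure ((fun z => z - τ) '' D.carrier) ⊆ J.carrier ∧
        (∀ i, J.IsCrosscut (L i) (xx i 0) (xx i 1)) ∧
        (∀ i, L i ⊆ gateO (![BS, BT] i) (F i) (![P₀, P₁] i) ρ ∪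
          (segment ℝ (![P₀, P₁] i - ((ρ / 64 : ℝ) : ℂ) - ((ρ / 128 : ℝ) : ℂ) * Complex.I) (![P₀, P₁] i - ((ρ / 64 : ℝ) : ℂ)) ∪
            segment ℝ (![P₀, P₁] i - ((ρ / 64 : ℝ) : ℂ)) (![P₀, P₁] i + ((ρ / 64 : ℝ) : ℂ)) ∪
            segment ℝ (![P₀, P₁] i + ((ρ / 64 : ℝ) : ℂ)) (![P₀, P₁] i + ((ρ / 64 : ℝ) : ℂ) - ((ρ / 128 : ℝ) : ℂ) * Complex.I)) ∪
            {xx i 0, xx i 1}) ∧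
        (∀ i, IsOpen (F i)) ∧ (∀ i, F i ⊆ J.carrier) ∧
        (∀ i, Disjoint (closure (F i)) (closure ((fun z => z - τ) '' D.carrier))) := by
  intro D a b hab δ ρ R N S T n n' q q' κ x τ P₀ P₁ H d β ε BS BT BpS BpT hρ hρR hRε hsep hs hs0 hτ hfam hgates hq2 hq2'
    hconv₀ hconv₁ habove₀ habove₁ hU₀ hU₁ hballs hqdom hHd hcone hexits hBS hBT hBpS hBpT hHS hHT hper
  -- Steps 0–3: gate and body data (`supGateData`)
  set U : ℕ → Set HexVertex := fun j => S (κ j) (n (κ j)) ∪ T (κ j) (n' (κ j)) with hUdef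
  set α : Fin 2 → ℂ := ![D.pt 0 - τ, D.pt 1 - τ] with hαdef
  set P : Fin 2 → ℂ := ![P₀, P₁] with hPdef
  set B : Fin 2 → Set ℂ := ![BS, BT] with hBdef
  set Bp : Fin 2 → ℕ → Set ℂ := ![BpS, BpT] with hBpdef
  obtain ⟨hPα, hαsep, hconv₀', hconv₁', habove₀', habove₁', hup, hBfar, hBc, hgB, hαB, hBα, hBne, hBb, hBpne, hBpb, hBpU, hHB, hq'S,
    -, hqΩ⟩ := supGateData D a b hab δ ρ R N S T n n' q q' κ x τ P₀ P₁ H d β ε BS BT BpS BpT hρ hρR hRε hsep hs hs0 hτ hfam hgates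
      hq2 hq2' hconv₀ hconv₁ habove₀ habove₁ hU₀ hU₁ hballs hqdom hHd hcone hexits hBS hBT hBpS hBpT hHS hHT hper
  -- Step 4: the envelope and the exits at drift `τ`, reach `R + ρ`, closeness `ρ/8`
  obtain ⟨r₁, r₂, J, η, xx, F, hr₁, hr₂, hJcar, hJfr, hclf, hclJ, hballα, hηcut, hηF, hFo, hFc, hFJ, hFcl, hFcone, hFx, hFwit,
    hxxfr⟩ := hexits τ (R + ρ) (ρ / 8) (by positivity)
  set f : ℂ ≃ₜ ℂ := H.trans (Homeomorph.addRight (-τ)) with hf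
  have hxxJ : ∀ i k, xx i k ∉ J.carrier := by
    intro i k hk
    have := hxxfr i k
    rw [J.isOpen.frontier_eq] at this
    exact this.2 hk
  have hτj : Tendsto (fun j => ((δ (κ j) : ℝ) : ℂ) * triEmbed (x j)) atTop (𝓝 τ) := hτ
  have hballcl : ∀ i, ball (P i) (ρ / 2) ⊆ closure ((fun z => z - τ) '' D.carrier) := by
    intro i
    refine ball_subset_closure_pinned (τj := fun j => ((δ (κ j) : ℝ) : ℂ) * triEmbed (x j)) hτj ?_
    filter_upwards [hballs] with j hj
    fin_cases i
    · exact hj.1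
    · exact hj.2
  have hballJ : ∀ i, ball (P i) (ρ / 2) ⊆ J.carrier := fun i => (hballcl i).trans hclJ
  have hαJ : ∀ i, closedBall (α i) (R + ρ) ⊆ J.carrier := by
    intro i; fin_cases i
    · exact hballα 0
    · exact hballα 1
  have hFball : ∀ i, Disjoint (F i) (ball (P i) (ρ / 2)) := fun i =>
    Set.disjoint_of_subset subset_closure ((hballcl i).trans (by rw [hclf])) (hFcl i)
  have hFZ : ∀ i, (F i ∩ {z : ℂ | infDist z (B i) < ρ / 8}).Nonempty := by
    intro i
    obtain ⟨z, hzF, hz⟩ := hFwit i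
    refine ⟨z, hzF, ?_⟩
    show infDist z (B i) < ρ / 8
    have hαi : D.pt i - τ = α i := by fin_cases i <;> rfl
    rw [hαi] at hz
    exact (infDist_le_dist_of_mem (hαB i)).trans_lt hz
  have hconefar : ∀ i k, i ≠ k → Disjoint (F k) (ball (α i) (R + ρ)) := by
    intro i k hik
    have h1 := hcone τ i k hik
    have hαi : α i = H (d i) - τ := by
      have : D.pt i - τ = α i := by fin_cases i <;> rfl
      rw [← this, ← hHd i]
    refine Set.disjoint_of_subset ((hFcone k).trans (image_mono fun w (hw : w ∈ {w : ℂ | 1 ≤ (w * conj (d k)).re ∧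
      (1 - β) * ‖w‖ < (w * conj (d k)).re}) => show w ∈ {w : ℂ | 1 ≤ (w * conj (d k)).re ∧ (1 - β) * ‖w‖ ≤ (w * conj (d k)).re}
      from ⟨hw.1, le_of_lt hw.2⟩)) ?_ h1
    rw [hαi]; exact ball_subset_ball hRε
  -- Step 5: the two corridors
  obtain ⟨hOo, hOc, hOJ, hOR, hOB, hOK, hdL, hdR, hRJ, hBJ, hWJ, hsepO, hsepB, hOX, hUHD, hgood, hOfine⟩ :=
    stub_carvedReduction_supCorridors J.carrier F B xx P α ρ R J.isOpen hρ hPα hαsep hballJ hαJ hBc hgB hBα hBfar hFo hFc hFJ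
      hFball hFZ hFx hxxJ hconefar
  -- Step 6: present pinned walks avoid the corridor zones
  have hFb : IsBounded (F 0 ∪ F 1) := (J.isBounded.subset (hFJ 0)).union (J.isBounded.subset (hFJ 1))
  have hFK : Disjoint (closure (F 0 ∪ F 1)) (closure ((fun z => z - τ) '' D.carrier)) := by
    rw [closure_union, hclf]
    exact Set.disjoint_union_left.2 ⟨hFcl 0, hFcl 1⟩
  have hwalk := stub_carvedReduction_walkOffZones D.carrier J.carrier (F 0 ∪ F 1) (fun j => δ (κ j)) x U τ B Bp (fun _ => ρ / 8) (ρ / 4) P (ρ / 2)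
    (ρ / 64) 60 hs hs0 hτj D.isBounded J.isOpen hclJ hFb hFK hBpU hHB hBpne hBpb hBne hBb (fun _ => by linarith) (by positivity)
    (by norm_num) hup
  -- Step 7: the link
  have hwalkJ : ∀ᶠ j in atTop, ∀ (u v : HexVertex) (w : (hexDomainGraph D.carrier (δ (κ j))).Walk u v),
      (∀ y ∈ w.support, y ∉ S (κ j) (n (κ j)) ∪ T (κ j) (n' (κ j))) → ((δ (κ j) : ℝ) : ℂ) * hexCenter u ∈ closure D.carrier →
      JoinedIn (J.carrier \ gateX B F P ρ) (((δ (κ j) : ℝ) : ℂ) * hexCenter u - ((δ (κ j) : ℝ) : ℂ) * triEmbed (x j))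
        (((δ (κ j) : ℝ) : ℂ) * hexCenter v - ((δ (κ j) : ℝ) : ℂ) * triEmbed (x j)) := by
    filter_upwards [hwalk] with j hj u v w hw hu
    exact (hj u v w hw hu).2.2.2
  have hlink : JoinedIn (J.carrier \ (gateO (B 0) (F 0) (P 0) ρ ∪ gateO (B 1) (F 1) (P 1) ρ ∪ gateRect (P 0) ρ ∪ gateRect (P 1) ρ))
      (P 0 + (((ρ / 128) / 2 : ℝ) : ℂ) * Complex.I) (P 1 + (((ρ / 128) / 2 : ℝ) : ℂ) * Complex.I) :=
    stub_carvedReduction_linkSup D a b δ ρ R S T n n' q q' κ x P (ρ / 128) (J.carrier \ gateX B F P ρ) _ hgates hq'S hwalkJ hgood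
      hρ (by positivity) hUHD hconv₀' hconv₁' habove₀' habove₁'
  -- Step 8: the framed super-domain
  have hdock : ∀ i (c₀ c₁ : ℂ), c₀ ∈ ball (P i) (ρ / 2) → c₁ ∈ ball (P i) (ρ / 2) → Disjoint (η i) (segment ℝ c₀ c₁) := by
    intro i c₀ c₁ h₀ h₁
    refine Set.disjoint_left.2 fun z hz hzs => ?_
    have hzball : z ∈ ball (P i) (ρ / 2) := (convex_ball _ _).segment_subset h₀ h₁ hzs
    by_cases hzx : z ∈ ({xx i 0, xx i 1} : Set ℂ)
    · rcases hzx with rfl | rfl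
      · exact hxxJ i 0 (hballJ i hzball)
      · exact hxxJ i 1 (hballJ i hzball)
    · exact Set.disjoint_left.1 (hFball i) (hηF i ⟨hz, hzx⟩) hzball
  have hdockpts : ∀ i, ∀ (σ : ℝ) (t : ℝ), |σ| ≤ ρ / 64 → 0 ≤ t → t ≤ ρ / 128 →
      P i - ((ρ / 128 : ℝ) : ℂ) * Complex.I + σ - (t : ℂ) * Complex.I ∈ ball (P i) (ρ / 2) := fun i σ t hσ ht0 ht1 =>
    stub_carvedReduction_superSup (P i) ρ σ t hρ hσ ht0 ht1
  obtain ⟨E, L, hE0, hE1, hLcut, hFL, hLO, hLR, hLB, hEJ, hjoin, hflat, hfront, hbox⟩ :=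
    stub_carvedReduction_superFrame J P (ρ / 64) (ρ / 128) (ρ / 128) (fun i => gateO (B i) (F i) (P i) ρ) η xx
      (by positivity) (by linarith) (by positivity) hRJ hBJ hWJ hOo hOc hOJ hOR hOB hOK hdL hdR hηcut
      (fun i => (hηF i).trans subset_union_right) (fun i => by
        have h0 := hdockpts i (-(ρ / 64)) 0 (by rw [abs_neg, abs_of_pos (by positivity)]) le_rfl (by positivity)
        have h1 := hdockpts i (-(ρ / 64)) ((ρ / 64) / 2) (by rw [abs_neg, abs_of_pos (by positivity)]) (by positivity) (by linarith)
        simp only [Complex.ofReal_neg, ← sub_eq_add_neg, Complex.ofReal_zero, zero_mul, sub_zero] at h0 h1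
        exact hdock i _ _ h0 h1)
      (fun i => by
        have h0 := hdockpts i (ρ / 64) 0 (by rw [abs_of_pos (by positivity)]) le_rfl (by positivity)
        have h1 := hdockpts i (ρ / 64) ((ρ / 64) / 2) (by rw [abs_of_pos (by positivity)]) (by positivity) (by linarith)
        simp only [Complex.ofReal_zero, zero_mul, sub_zero] at h0 h1
        exact hdock i _ _ h0 h1)
      hsepO hsepB hlink
  -- Step 9: the reach clause
  have hCut : (L 0 ∪ L 1) ∩ J.carrier ⊆ ((F 0 ∪ F 1) ∪ ⋃ i, {z : ℂ | infDist z (B i) < ρ / 8}) ∪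
      ⋃ i, ({z : ℂ | |z.re - (P i).re| ≤ ρ / 64 ∧ (P i).im - ρ / 128 ≤ z.im ∧ z.im ≤ (P i).im} ∪
        ({z : ℂ | z.im < (P i).im - ρ / 128} ∩ ball (P i) (ρ / 2 - ρ / 64))) := by
    rintro z ⟨hzL, hzJ⟩
    have key : ∀ i, z ∈ L i → z ∈ ((F 0 ∪ F 1) ∪ ⋃ i, {z : ℂ | infDist z (B i) < ρ / 8}) ∪
        ⋃ i, ({z : ℂ | |z.re - (P i).re| ≤ ρ / 64 ∧ (P i).im - ρ / 128 ≤ z.im ∧ z.im ≤ (P i).im} ∪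
          ({z : ℂ | z.im < (P i).im - ρ / 128} ∩ ball (P i) (ρ / 2 - ρ / 64))) := by
      intro i hz
      rcases hLO i hz with (hzO | hzF) | hzx
      · rcases hOfine i hzO with (h | h) | h
        · refine Or.inl (Or.inl ?_)
          fin_cases i
          · exact Or.inl h
          · exact Or.inr h
        · exact Or.inl (Or.inr (mem_iUnion.2 ⟨i, h⟩))
        · exact Or.inr (mem_iUnion.2 ⟨i, Or.inr h⟩)
      · exact Or.inr (mem_iUnion.2 ⟨i, Or.inl (frame_subset_rect (g := P i) (by positivity) (by positivity) hzF)⟩)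
      · exfalso
        rcases hzx with rfl | rfl
        · exact hxxJ i 0 hzJ
        · exact hxxJ i 1 hzJ
    rcases hzL with h | h
    · exact key 0 h
    · exact key 1 h
  have hgoodCut : J.carrier \ (gateO (B 0) (F 0) (P 0) ρ ∪ gateO (B 1) (F 1) (P 1) ρ ∪ gateRect (P 0) ρ ∪ gateRect (P 1) ρ) ⊆
      J.carrier \ (L 0 ∪ L 1) := by
    rintro z ⟨hzJ, hz⟩
    refine ⟨hzJ, ?_⟩
    rintro (hzL | hzL)
    · rcases hLO 0 hzL with (h | h) | h
      · exact hz (Or.inl (Or.inl (Or.inl h)))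
      · exact hz (Or.inl (Or.inr (frame_subset_rect (g := P 0) (by positivity) (by positivity) h)))
      · rcases h with rfl | rfl <;> exact hxxJ 0 _ hzJ
    · rcases hLO 1 hzL with (h | h) | h
      · exact hz (Or.inl (Or.inl (Or.inr h)))
      · exact hz (Or.inr (frame_subset_rect (g := P 1) (by positivity) (by positivity) h))
      · rcases h with rfl | rfl <;> exact hxxJ 1 _ hzJ
  have hstart : ∀ᶠ j in atTop, JoinedIn (J.carrier \ (L 0 ∪ L 1)) (((δ (κ j) : ℝ) : ℂ) * hexCenter (q (κ j)) - ((δ (κ j) : ℝ) : ℂ) * triEmbed (x j))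
      (P 0 + (((ρ / 128) / 2 : ℝ) : ℂ) * Complex.I) := by
    filter_upwards [eventually_mem_upperHalfDisc (by positivity : (0 : ℝ) < ρ / 128) hconv₀' habove₀'] with j hj
    exact JoinedIn.of_segment_subset ((((convex_halfSpace_im_gt _).inter (convex_ball _ _)).segment_subset hj
      (bulkPoint_mem_upperHalfDisc (P 0) (by positivity))).trans ((hUHD 0).trans hgoodCut))
  have hreach := stub_carvedReduction_reachSup D.carrier J.carrier E.carrier (L 0 ∪ L 1) (F 0 ∪ F 1)
    (P 0 + (((ρ / 128) / 2 : ℝ) : ℂ) * Complex.I) P B (fun _ => ρ / 8) (fun j => δ (κ j)) x U (fun j => q (κ j)) (ρ / 64) (ρ / 128) (ρ / 2) (ρ / 64)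
    hs hs0 (by positivity) (by positivity) (by positivity) (by linarith) (by
      have := hPα 0; have := hPα 1
      linarith [dist_triangle (α 0) (P 0) (α 1), dist_triangle (P 0) (P 1) (α 1), dist_comm (P 0) (α 0), dist_comm (P 1) (α 1)])
    hjoin hCut hqΩ hwalk hstart hup
  -- Step 10: assemble
  have hEP : ∀ i, E.pt i = P i := Fin.forall_fin_two.2 ⟨hE0, hE1⟩
  refine ⟨E, J, L, F, xx, hE0, hE1, ?_, ?_, ?_, hEJ, hjoin, hfront, hclJ, hLcut, ?_, hFo, hFJ, fun i => by rw [hclf]; exact hFcl i⟩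
  · intro i
    rw [hEP i]; exact hflat i
  · intro i z h1 h2 h3
    rw [hEP i] at h1 h2 h3
    exact hbox i z h1 h2 h3
  · filter_upwards [hreach] with j hj w π hπ y hy
    obtain ⟨hyE, hdisc⟩ := hj w π hπ y hy
    refine ⟨hyE, hdisc.trans (union_subset_union_right _ (iUnion_mono fun i => ?_))⟩
    intro z hz
    rw [hEP i]; exact hz
  · intro i
    fin_cases i
    · exact hLO 0
    · exact hLO 1

end Summit.CriticalPhenomena.SAWScalingLimit.Theorems.ObservableToSLE.TypeLadder

end
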